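import Literature.Geometry.GaugeTheory.BPSTModuliInformationMetric
import Literature.Geometry.GaugeTheory.BPSTModuliContinuity
import HarnessLib

/-!
# The flat collar: every local clause of the Groisser–Murray collar asymptotics holds for the
# BPST family in `M₁(ℝ⁴)`

Topic `Literature/Geometry/GaugeTheory`; companion *proofs* file (theorems only: no definition, no
named fact) of `BPSTModuliInformationMetric.lean` and `BPSTModuliContinuity.lean`, closing the
flat-model study of the cited fact `informationMetric_collarAsymptotics`
(`InstantonCollarInformationMetric.lean`, Groisser–Murray 1997 Thm. 3.1 + Donaldson's collar).

* `BPST.continuousOn_moduliMap` — the family `Ψ₀(a, λ) = [A_{a,λ}]` (`BPST.moduliMap`) is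
  continuous on `ℝ⁴ × (0, ∞)` for the quotient `C^∞` topology of `M₁(ℝ⁴)`;
* `BPST.flatCollar` — over flat `ℝ⁴` the map `Ψ₀` satisfies, on `ℝ⁴ × (0, t)` for every `t > 0`,
  EVERY clause of `informationMetric_collarAsymptotics` that is local to the collar:
  continuity, injectivity, joint smoothness of the densities, concentration, and the
  information-metric asymptotics — the last one exactly, `𝐠 = (128π²/5)(dλ² + δ)/λ²`.
  The two remaining clauses of the fact (co-compactness of `M₁ ∖ Ψ(Σ × (0,t))` and the closure
  relation) are global statements about the compact base and have no flat counterpart.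

## References

* D. Groisser, M. K. Murray, *Instantons and the information metric* (1997), Thm. 3.1, §3.
  [GroisserMurray1997]
-/

noncomputable section

open scoped Manifold ContDiff Topology
open Set Function MeasureTheory
open Literature.Geometry.Riemannian (euclideanMetric)
open Literature.Topology.FourManifolds

namespace Literature.Geometry.GaugeTheory

namespace BPST

/-- **`Ψ₀` is continuous on `ℝ⁴ × (0, ∞)`** for the quotient `C^∞` topology of `M₁(ℝ⁴)`
(`BPST.continuous_mk_instanton_Ioi`) — the flat case of the clause
`ContinuousOn Ψ (univ ×ˢ Ioo 0 λ₀)`. [cite: GroisserMurray1997, §3 p. 6] -/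
theorem continuousOn_moduliMap :
    ContinuousOn moduliMap ((univ : Set (EuclideanSpace ℝ (Fin 4))) ×ˢ Ioi (0 : ℝ)) := by
  rw [continuousOn_iff_continuous_restrict]
  have h : ((univ : Set (EuclideanSpace ℝ (Fin 4))) ×ˢ Ioi (0 : ℝ)).restrict moduliMap =
      fun q ↦ AsdModuliSpace.mk (instanton q.1.1 (basePoint (EuclideanSpace ℝ (Fin 4)))
        (mem_Ioi.1 q.2.2).ne') := by
    funext q
    exact moduliMap_eq q.1.1 (mem_Ioi.1 q.2.2).ne'
  rw [h]
  exact continuous_mk_instanton_Ioi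

/-- **The flat collar.** Over flat `ℝ⁴` the BPST family `Ψ₀(a, λ) = [A_{a,λ}] ∈ M₁(ℝ⁴)` satisfies
on `ℝ⁴ × (0, t)`, for every `t > 0` and with `c = 128π²/5`, every local clause of
`informationMetric_collarAsymptotics` in its exact shape: `Ψ₀` is continuous and injective, the
densities `((a,λ), x) ↦ ρ_{Ψ₀(a,λ)}(x)` are jointly smooth, `sup ρ → ∞` uniformly as `λ → 0`, and
`|𝐠((v,s),(v,s)) − c (s² + δ(v,v))/λ²| ≤ ε · c (s² + δ(v,v))/λ²` for every `ε > 0` (indeed with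
`0` on the left). [cite: GroisserMurray1997, Thm. 3.1, §3 pp. 6–8] -/
theorem flatCollar (hg : (euclideanMetric (EuclideanSpace ℝ (Fin 4))).IsRiemannian) {t : ℝ}
    (ht : 0 < t) :
    ContinuousOn moduliMap ((univ : Set (EuclideanSpace ℝ (Fin 4))) ×ˢ Ioo 0 t) ∧
    InjOn moduliMap ((univ : Set (EuclideanSpace ℝ (Fin 4))) ×ˢ Ioo 0 t) ∧
    ContMDiffOn (((𝓡 4).prod 𝓘(ℝ, ℝ)).prod (𝓡 4)) 𝓘(ℝ, ℝ) ∞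
      (fun q : (EuclideanSpace ℝ (Fin 4) × ℝ) × EuclideanSpace ℝ (Fin 4) ↦
        (moduliMap q.1).density (euclideanMetric (EuclideanSpace ℝ (Fin 4))) q.2)
      (((univ : Set (EuclideanSpace ℝ (Fin 4))) ×ˢ Ioo 0 t) ×ˢ univ) ∧
    (∀ R : ℝ, ∃ t' ∈ Ioo 0 t, ∀ p ∈ (univ : Set (EuclideanSpace ℝ (Fin 4))) ×ˢ Ioo 0 t',
      ∃ x, R ≤ (moduliMap p).density (euclideanMetric (EuclideanSpace ℝ (Fin 4))) x) ∧
    (∀ ε : ℝ, 0 < ε → ∀ (σ : EuclideanSpace ℝ (Fin 4)) (l : ℝ), l ∈ Ioo 0 t →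
      ∀ (v : TangentSpace (𝓡 4) σ) (s : ℝ),
        |(∫ x, (mvfderiv ((𝓡 4).prod 𝓘(ℝ, ℝ))
                  (fun p : EuclideanSpace ℝ (Fin 4) × ℝ ↦
                    (moduliMap p).density (euclideanMetric (EuclideanSpace ℝ (Fin 4))) x)
                  (σ, l) (v, s)) ^ 2 /
                (moduliMap (σ, l)).density (euclideanMetric (EuclideanSpace ℝ (Fin 4))) x
              ∂(volMeasure (euclideanMetric (EuclideanSpace ℝ (Fin 4))) hg)) -
            128 * Real.pi ^ 2 / 5 *
              (s ^ 2 + (euclideanMetric (EuclideanSpace ℝ (Fin 4))).val σ v v) / l ^ 2|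
          ≤ ε * (128 * Real.pi ^ 2 / 5 *
              (s ^ 2 + (euclideanMetric (EuclideanSpace ℝ (Fin 4))).val σ v v) / l ^ 2)) :=
  ⟨continuousOn_moduliMap.mono (prod_mono le_rfl Ioo_subset_Ioi_self),
    informationMetric_moduliMap hg ht⟩

end BPST

end Literature.Geometry.GaugeTheory

end
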